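import Mathlib.AlgebraicGeometry.AffineScheme
import Mathlib.AlgebraicGeometry.Restrict
import Mathlib.AlgebraicGeometry.IdealSheaf.Functorial
import Literature.AlgebraicGeometry.Resolution.WeightedResolutionDatum
import Literature.AlgebraicGeometry.Resolution.IdealSheafLemmas
import Summits.ResolutionOfSingularities.ResolutionOfSingularities.Theorems.WeightedInvariantWeightedConstructionExtReesLocalization
import Summits.ResolutionOfSingularities.ResolutionOfSingularities.Theorems.WeightedInvariantWeightedConstructionOffExceptional

/-!
# The cobordant blow-up of a basic open is an open piece of the cobordant blow-up

Route `ResolutionOfSingularities/WeightedInvariant`, crux `WeightedConstruction`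
(stmt-ResolutionOfSingularities-0571), line `support-first-weights-second`, stub
`stub_cobordantPlus_basicOpen_openImmersion` (stub R2b of the lead skeleton; CONDITIONAL on the
ring statement `H` = stub R2a `stub_strictTransform_localization`, taken as a hypothesis).

What is proved. For a Rees algebra `R` on a scheme `Y` (`ReesAlgebraData`,
`WeightedResolutionDatum.lean`), an affine open `U`, a section `h ∈ Γ(Y, U)` and an ideal sheaf
`X`, there is an open immersion `j : B₊(D(h)) → B₊(U)` between the cobordant blow-ups of the
charts `D(h) ⊆ U` (Włodarczyk, arXiv:2203.03090, Def. 2.3.5) which commutes with the maps to `Y`,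
pulls the strict transform of `X ∩ U` (3.3.12–3.3.13) back to the strict transform of `X ∩ D(h)`,
matches the exceptional divisors `V(t⁻¹)`, and whose image contains every point of `B₊(U)` over
`D(h)` — the chartwise computation of the relative spectrum `B = Spec_Y(𝒪_Y[t⁻¹, Rₙ tⁿ])`
(App. Def. 5.1.1).

How. Notation: `A = Γ(Y, U)`, `A' = Γ(Y, D(h)) = A[1/h]`, `I = R.chartIdeals U`, `I'ₙ = Iₙ A'`
(quasi-coherence, `IdealSheafData.map_ideal_basicOpen`), `S = A[t⁻¹, Iₙ tⁿ] = extReesAlgebra I`,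
`B = Spec S = affineCobordantBlowup I ⊇ B₊ = B ∖ Vert(B)`, likewise `S'`, `B'`, `B'₊`. The tree's
`stub_extReesAlgebra_localization` gives the base change of Laurent polynomials
`ψ : S → S' = S[1/h]`; the hypothesis `H` gives `ψ t⁻¹ = t⁻¹`, `(vertex ideal) S' = vertex ideal`,
`σˢ(𝔞) S' = σˢ(𝔞 A')`. Then, for `φ = Spec ψ : B' → B` (namespace `CobordantPlusBasicOpen`):

* `specMap_π` — `φ` lies over `Spec A' → Spec A` (`ψ` extends the restriction map);
* `isOpenImmersion_specMap`, `range_specMap` — `φ` is an open immersion onto `D(h)`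
  (`IsOpenImmersion.of_isLocalization`, `PrimeSpectrum.localization_away_comap_range`);
* `comap_idealSheaf_specMap` — `φ⁻¹` of the ideal sheaf of `J ≤ S` is the ideal sheaf of `J S'`
  (`comap_ofIdealTop_SpecMap` of the tree); hence `preimage_plusOpens` (`φ⁻¹ B₊ = B'₊`),
  `specMap_mem_support_exceptional_iff` (exceptional divisors match) and
  `comap_strictTransformPlus_resLE` (strict transforms match along the restriction
  `j = φ.resLE B₊ B'₊ : B'₊ → B₊`, Mathlib `Scheme.Hom.resLE`);
* `exists_openImmersion_plus`, `exists_openImmersion_cobordantPlus` — assembly over `Spec A`,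
  resp. over `Y` (composing with `Spec Γ(Y, U) → Y`, `IsAffineOpen.map_fromSpec`);
* the stub: a point of `B₊(U)` maps into `D(h) ⊆ Y` iff `h` is not in the contraction of its
  prime to `A` (`IsAffineOpen.fromSpec_preimage_basicOpen`), i.e. iff it lies in `D(h) ⊆ B`, the
  image of `φ`.
-/


set_option linter.dupNamespace false -- mandated namespace of this single-conjunct summit

namespace Summit.ResolutionOfSingularities.ResolutionOfSingularities.Theorems

open CategoryTheory AlgebraicGeometry TopologicalSpace Literature.AlgebraicGeometry.Resolution
open scoped LaurentPolynomial

namespace CobordantPlusBasicOpen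

universe u

section Affine

/-! Throughout, `φ : B' → B` is `Spec ψ` *typed over the full cobordant blow-ups*
(`affineCobordantBlowup I = Spec S` is a definition): a variable `φ` with the hypothesis
`hφ : φ = Spec.map (CommRingCat.ofHom ψ)`, so that all statements elaborate over
`affineCobordantBlowup` and no auxiliary definition is needed. -/

variable {A A' : Type u} [CommRing A] [CommRing A'] (I : ℕ → Ideal A) (I' : ℕ → Ideal A')
  (ψ : extReesAlgebra I →+* extReesAlgebra I')
  (φ : affineCobordantBlowup I' ⟶ affineCobordantBlowup I)
  (hφ : φ = Spec.map (CommRingCat.ofHom ψ))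

include hφ

/-- `Spec ψ : B' → B` lies over `Spec ρ : Spec A' → Spec A` when `ψ` extends `ρ` along the
structure maps. [folklore] -/
theorem specMap_π (ρ : A →+* A')
    (hψC : ∀ a : A, ψ (algebraMap A (extReesAlgebra I) a) =
      algebraMap A' (extReesAlgebra I') (ρ a)) :
    φ ≫ affineCobordantBlowup.π I =
      affineCobordantBlowup.π I' ≫ Spec.map (CommRingCat.ofHom ρ) := by
  subst hφ
  unfold affineCobordantBlowup.π affineCobordantBlowup
  rw [← Spec.map_comp, ← Spec.map_comp, ← CommRingCat.ofHom_comp, ← CommRingCat.ofHom_comp]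
  congr 2
  exact RingHom.ext fun a => hψC a

/-- If `S' = S[1/r]` along `ψ`, then `Spec ψ : B' → B` is an open immersion. [folklore] -/
theorem isOpenImmersion_specMap (r : extReesAlgebra I)
    (hloc : @IsLocalization.Away (extReesAlgebra I) _ r (extReesAlgebra I') _ ψ.toAlgebra) :
    IsOpenImmersion φ := by
  letI := ψ.toAlgebra
  haveI := hloc
  subst hφ
  exact IsOpenImmersion.of_isLocalization r

/-- If `S' = S[1/r]` along `ψ`, then the image of `Spec ψ : B' → B` is `D(r)`. [folklore] -/
theorem range_specMap (r : extReesAlgebra I)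
    (hloc : @IsLocalization.Away (extReesAlgebra I) _ r (extReesAlgebra I') _ ψ.toAlgebra) :
    Set.range φ = (PrimeSpectrum.basicOpen r : Set (PrimeSpectrum (extReesAlgebra I))) := by
  letI := ψ.toAlgebra
  haveI := hloc
  subst hφ
  exact PrimeSpectrum.localization_away_comap_range (extReesAlgebra I') r

/-- The inverse image along `Spec ψ` of the ideal sheaf of `J ≤ S` on `B` is the ideal sheaf of
`J S'` on `B'`. [folklore] -/
theorem comap_idealSheaf_specMap (J : Ideal (extReesAlgebra I)) :
    (affineCobordantBlowup.idealSheaf I J).comap φ =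
      affineCobordantBlowup.idealSheaf I' (J.map ψ) := by
  subst hφ
  unfold affineCobordantBlowup.idealSheaf affineCobordantBlowup
  exact comap_ofIdealTop_SpecMap ψ J

/-- The points of `B'` are sent by `Spec ψ` to their contractions. [folklore] -/
theorem specMap_asIdeal (x : affineCobordantBlowup I') :
    (φ x).asIdeal = x.asIdeal.comap ψ := by
  subst hφ
  rfl

/-- If `ψ` maps the vertex ideal of `S` onto the vertex ideal of `S'`, then a point of `B'` maps
into `B₊` iff it lies in `B'₊`. [folklore] -/
theorem specMap_mem_plusOpens_iff
    (hvert : (extReesAlgebra.vertexIdeal I).map ψ = extReesAlgebra.vertexIdeal I')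
    (x : affineCobordantBlowup I') :
    φ x ∈ affineCobordantBlowup.plusOpens I ↔
      x ∈ affineCobordantBlowup.plusOpens I' := by
  rw [OffExceptional.mem_plusOpens_iff, OffExceptional.mem_plusOpens_iff, ← hvert,
    Ideal.map_le_iff_le_comap, specMap_asIdeal I I' ψ φ hφ]

/-- If `ψ` maps the vertex ideal of `S` onto the vertex ideal of `S'`, then
`(Spec ψ)⁻¹ B₊ = B'₊`. [folklore] -/
theorem preimage_plusOpens
    (hvert : (extReesAlgebra.vertexIdeal I).map ψ = extReesAlgebra.vertexIdeal I') :
    φ ⁻¹ᵁ affineCobordantBlowup.plusOpens I = affineCobordantBlowup.plusOpens I' := by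
  ext x
  exact specMap_mem_plusOpens_iff I I' ψ φ hφ hvert x

/-- If `ψ t⁻¹ = t⁻¹`, then `Spec ψ` matches the exceptional divisors: `(Spec ψ) x ∈ V(t⁻¹)` iff
`x ∈ V(t⁻¹)`. [folklore] -/
theorem specMap_mem_support_exceptional_iff
    (hs : ψ (extReesAlgebra.tInv I) = extReesAlgebra.tInv I') (x : affineCobordantBlowup I') :
    φ x ∈ ((affineCobordantBlowup.exceptional I).support : Set (affineCobordantBlowup I)) ↔
      x ∈ ((affineCobordantBlowup.exceptional I').support : Set (affineCobordantBlowup I')) := by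
  rw [← not_iff_not]
  change φ x ∉ (affineCobordantBlowup.exceptional I).support ↔
    x ∉ (affineCobordantBlowup.exceptional I').support
  rw [OffExceptional.not_mem_support_exceptional_iff,
    OffExceptional.not_mem_support_exceptional_iff, ← hs, specMap_asIdeal I I' ψ φ hφ,
    Ideal.mem_comap]

/-- If `ψ` maps the strict transform `σˢ(𝔞)` onto the strict transform `σˢ(𝔞')`, then along the
restriction `j : B'₊ → B₊` of `Spec ψ` the strict transform of `V(𝔞)` on `B₊` pulls back to the
strict transform of `V(𝔞')` on `B'₊` (Włodarczyk 3.3.12–3.3.13). [cite: Wlodarczyk2022, 3.3.12] -/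
theorem comap_strictTransformPlus_resLE
    (hle : affineCobordantBlowup.plusOpens I' ≤ φ ⁻¹ᵁ affineCobordantBlowup.plusOpens I)
    {𝔞 : Ideal A} {𝔞' : Ideal A'}
    (hst : (extReesAlgebra.strictTransform I 𝔞).map ψ = extReesAlgebra.strictTransform I' 𝔞') :
    (affineCobordantBlowup.strictTransformPlus I 𝔞).comap
        (φ.resLE (affineCobordantBlowup.plusOpens I) (affineCobordantBlowup.plusOpens I') hle) =
      affineCobordantBlowup.strictTransformPlus I' 𝔞' := by
  unfold affineCobordantBlowup.strictTransformPlus affineCobordantBlowup.plus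
  rw [← Scheme.IdealSheafData.comap_comp, Scheme.Hom.resLE_comp_ι,
    Scheme.IdealSheafData.comap_comp, comap_idealSheaf_specMap I I' ψ φ hφ, hst]

/-- If `S' = S[1/r]` along `ψ` and `ψ` maps the vertex ideal onto the vertex ideal, every point of
`B₊` at which `r` does not vanish is the image of a point of `B'₊`. [folklore] -/
theorem exists_specMap_eq (r : extReesAlgebra I)
    (hloc : @IsLocalization.Away (extReesAlgebra I) _ r (extReesAlgebra I') _ ψ.toAlgebra)
    (hvert : (extReesAlgebra.vertexIdeal I).map ψ = extReesAlgebra.vertexIdeal I')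
    {b : affineCobordantBlowup I} (hb : b ∈ affineCobordantBlowup.plusOpens I)
    (hr : r ∉ b.asIdeal) :
    ∃ x : affineCobordantBlowup I', x ∈ affineCobordantBlowup.plusOpens I' ∧ φ x = b := by
  have hmem : b ∈ Set.range φ := by
    rw [range_specMap I I' ψ φ hφ r hloc]
    exact hr
  obtain ⟨x, rfl⟩ := hmem
  exact ⟨x, (specMap_mem_plusOpens_iff I I' ψ φ hφ hvert x).mp hb, rfl⟩

end Affine

/-! ## Assembly -/

section Assembly

variable {A A' : Type u} [CommRing A] [CommRing A'] (I : ℕ → Ideal A) (I' : ℕ → Ideal A')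
  (ψ : extReesAlgebra I →+* extReesAlgebra I')

/-- **Affine assembly.** Let `ψ : S = A[t⁻¹, Iₙ tⁿ] → S' = A'[t⁻¹, I'ₙ tⁿ]` extend `ρ : A → A'`,
make `S'` the localisation of `S` away from `r`, fix `t⁻¹`, map the vertex ideal onto the vertex
ideal and the strict transform `σˢ(𝔞)` onto `σˢ(𝔞')`. Then the restriction `j : B'₊ → B₊` of
`Spec ψ` is an open immersion over `Spec ρ`, pulls the strict transform of `V(𝔞)` back to that of
`V(𝔞')`, matches the exceptional divisors, and its image contains every point of `B₊` at which
`r` does not vanish (Włodarczyk, Def. 2.3.5 and 3.3.12–3.3.13, for the open piece `D(r)`).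
[cite: Wlodarczyk2022, Def. 2.3.5] -/
theorem exists_openImmersion_plus (ρ : A →+* A') (r : extReesAlgebra I)
    (hloc : @IsLocalization.Away (extReesAlgebra I) _ r (extReesAlgebra I') _ ψ.toAlgebra)
    (hψC : ∀ a : A, ψ (algebraMap A (extReesAlgebra I) a) =
      algebraMap A' (extReesAlgebra I') (ρ a))
    (hs : ψ (extReesAlgebra.tInv I) = extReesAlgebra.tInv I')
    (hvert : (extReesAlgebra.vertexIdeal I).map ψ = extReesAlgebra.vertexIdeal I')
    {𝔞 : Ideal A} {𝔞' : Ideal A'}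
    (hst : (extReesAlgebra.strictTransform I 𝔞).map ψ = extReesAlgebra.strictTransform I' 𝔞') :
    ∃ j : (affineCobordantBlowup.plusOpens I' : Scheme.{u}) ⟶ affineCobordantBlowup.plusOpens I,
      IsOpenImmersion j ∧
      j ≫ affineCobordantBlowup.plusπ I =
        affineCobordantBlowup.plusπ I' ≫ Spec.map (CommRingCat.ofHom ρ) ∧
      (affineCobordantBlowup.strictTransformPlus I 𝔞).comap j =
        affineCobordantBlowup.strictTransformPlus I' 𝔞' ∧
      (∀ b' : affineCobordantBlowup.plusOpens I',
        (affineCobordantBlowup.plusOpens I).ι (j b') ∈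
            ((affineCobordantBlowup.exceptional I).support : Set (affineCobordantBlowup I)) ↔
          (affineCobordantBlowup.plusOpens I').ι b' ∈
            ((affineCobordantBlowup.exceptional I').support : Set (affineCobordantBlowup I'))) ∧
      (∀ b : affineCobordantBlowup.plusOpens I,
        r ∉ ((affineCobordantBlowup.plusOpens I).ι b).asIdeal → ∃ b', j b' = b) := by
  -- `φ = Spec ψ`, typed over the full cobordant blow-ups
  obtain ⟨φ, hφ⟩ : ∃ φ : affineCobordantBlowup I' ⟶ affineCobordantBlowup I,
      φ = Spec.map (CommRingCat.ofHom ψ) := ⟨_, rfl⟩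
  haveI : IsOpenImmersion φ := isOpenImmersion_specMap I I' ψ φ hφ r hloc
  have hle : affineCobordantBlowup.plusOpens I' ≤ φ ⁻¹ᵁ affineCobordantBlowup.plusOpens I :=
    (preimage_plusOpens I I' ψ φ hφ hvert).ge
  have hjι := Scheme.Hom.resLE_comp_ι φ hle
  refine ⟨φ.resLE _ _ hle, ?_, ?_, comap_strictTransformPlus_resLE I I' ψ φ hφ hle hst, ?_, ?_⟩
  · -- an open immersion: `j ≫ ι = ι' ≫ φ` is one
    haveI : IsOpenImmersion (φ.resLE _ _ hle ≫ (affineCobordantBlowup.plusOpens I).ι) := by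
      rw [hjι]
      infer_instance
    exact IsOpenImmersion.of_comp _ (affineCobordantBlowup.plusOpens I).ι
  · -- over `Spec ρ` (a `calc`, composing by terms: the objects `B₊ = ↑(plusOpens I)` and
    -- `plus I` agree only up to unfolding)
    calc φ.resLE _ _ hle ≫ affineCobordantBlowup.plusπ I
        = (φ.resLE _ _ hle ≫ (affineCobordantBlowup.plusOpens I).ι) ≫
            affineCobordantBlowup.π I := (Category.assoc _ _ _).symm
      _ = ((affineCobordantBlowup.plusOpens I').ι ≫ φ) ≫ affineCobordantBlowup.π I := by rw [hjι]
      _ = (affineCobordantBlowup.plusOpens I').ι ≫ (φ ≫ affineCobordantBlowup.π I) :=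
          Category.assoc _ _ _
      _ = (affineCobordantBlowup.plusOpens I').ι ≫
            (affineCobordantBlowup.π I' ≫ Spec.map (CommRingCat.ofHom ρ)) := by
          rw [specMap_π I I' ψ φ hφ ρ hψC]
      _ = affineCobordantBlowup.plusπ I' ≫ Spec.map (CommRingCat.ofHom ρ) :=
          (Category.assoc _ _ _).symm
  · -- exceptional divisors match
    intro b'
    rw [Scheme.Opens.ι_apply, Scheme.Opens.ι_apply, Scheme.Hom.coe_resLE_apply]
    exact specMap_mem_support_exceptional_iff I I' ψ φ hφ hs _
  · -- the image contains `B₊ ∩ D(r)`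
    intro b hb
    obtain ⟨x, hx, hxb⟩ := exists_specMap_eq I I' ψ φ hφ r hloc hvert b.2 hb
    exact ⟨⟨x, hx⟩, Subtype.ext ((Scheme.Hom.coe_resLE_apply _ _ _).trans hxb)⟩

/-- **Assembly over a scheme.** For a Rees algebra `R` on a scheme `Y`, affine opens `V ≤ U` and
an ideal sheaf `X`: if `ψ : Γ(B(U)) = Γ(Y,U)[t⁻¹, Rₙ(U) tⁿ] → Γ(B(V))` extends the restriction
`Γ(Y, U) → Γ(Y, V)`, makes `Γ(B(V))` the localisation of `Γ(B(U))` away from `r`, fixes `t⁻¹`,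
and maps the vertex ideal onto the vertex ideal and the strict transform of `X(U)` onto that of
`X(V)`, then the restriction `j : B₊(V) → B₊(U)` of `Spec ψ` is an open immersion over `Y`
compatible with the strict transforms of `X` and with the exceptional divisors, and its image
contains every point of `B₊(U)` at which `r` does not vanish. [cite: Wlodarczyk2022, Def. 2.3.5] -/
theorem exists_openImmersion_cobordantPlus {Y : Scheme.{u}} (R : ReesAlgebraData Y)
    (U V : Y.affineOpens) (hVU : (V : Y.Opens) ≤ U) (X : Y.IdealSheafData)
    (ψ : extReesAlgebra (R.chartIdeals U) →+* extReesAlgebra (R.chartIdeals V))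
    (r : extReesAlgebra (R.chartIdeals U))
    (hloc : @IsLocalization.Away (extReesAlgebra (R.chartIdeals U)) _ r
      (extReesAlgebra (R.chartIdeals V)) _ ψ.toAlgebra)
    (hψC : ∀ a : Γ(Y, U), ψ (algebraMap Γ(Y, U) (extReesAlgebra (R.chartIdeals U)) a) =
      algebraMap Γ(Y, V) (extReesAlgebra (R.chartIdeals V))
        ((Y.presheaf.map (homOfLE hVU).op).hom a))
    (hs : ψ (extReesAlgebra.tInv (R.chartIdeals U)) = extReesAlgebra.tInv (R.chartIdeals V))
    (hvert : (extReesAlgebra.vertexIdeal (R.chartIdeals U)).map ψ =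
      extReesAlgebra.vertexIdeal (R.chartIdeals V))
    (hst : (extReesAlgebra.strictTransform (R.chartIdeals U) (X.ideal U)).map ψ =
      extReesAlgebra.strictTransform (R.chartIdeals V) (X.ideal V)) :
    ∃ j : R.cobordantPlus V ⟶ R.cobordantPlus U, IsOpenImmersion j ∧
      j ≫ R.cobordantPlusι U = R.cobordantPlusι V ∧
      (R.cobordantStrictTransform U X).comap j = R.cobordantStrictTransform V X ∧
      (∀ b' : R.cobordantPlus V,
        (affineCobordantBlowup.plusOpens (R.chartIdeals U)).ι (j b') ∈
            ((affineCobordantBlowup.exceptional (R.chartIdeals U)).support :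
              Set (affineCobordantBlowup (R.chartIdeals U))) ↔
          (affineCobordantBlowup.plusOpens (R.chartIdeals V)).ι b' ∈
            ((affineCobordantBlowup.exceptional (R.chartIdeals V)).support :
              Set (affineCobordantBlowup (R.chartIdeals V)))) ∧
      (∀ b : R.cobordantPlus U,
        r ∉ ((affineCobordantBlowup.plusOpens (R.chartIdeals U)).ι b).asIdeal →
          ∃ b', j b' = b) := by
  obtain ⟨j, h1, h2, h3, h4, h5⟩ := exists_openImmersion_plus (R.chartIdeals U) (R.chartIdeals V)
    ψ (Y.presheaf.map (homOfLE hVU).op).hom r hloc hψC hs hvert hst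
  -- over `Y`: compose with `Spec Γ(Y, U) → Y`, `Spec Γ(Y, V) → Y` (a `calc` by terms: the objects
  -- `R.cobordantPlus U`, `plus _` and `↑(plusOpens _)` agree only up to unfolding)
  have h2' : j ≫ affineCobordantBlowup.plusπ (R.chartIdeals U) =
      affineCobordantBlowup.plusπ (R.chartIdeals V) ≫
        Spec.map (Y.presheaf.map (homOfLE hVU).op) := h2
  have e1 : j ≫ R.cobordantPlusι U =
      (j ≫ affineCobordantBlowup.plusπ (R.chartIdeals U)) ≫ U.2.fromSpec :=
    (Category.assoc _ _ _).symm
  have e2 : (j ≫ affineCobordantBlowup.plusπ (R.chartIdeals U)) ≫ U.2.fromSpec =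
      (affineCobordantBlowup.plusπ (R.chartIdeals V) ≫
        Spec.map (Y.presheaf.map (homOfLE hVU).op)) ≫ U.2.fromSpec :=
    h2' =≫ U.2.fromSpec
  have e3 : (affineCobordantBlowup.plusπ (R.chartIdeals V) ≫
        Spec.map (Y.presheaf.map (homOfLE hVU).op)) ≫ U.2.fromSpec =
      affineCobordantBlowup.plusπ (R.chartIdeals V) ≫
        (Spec.map (Y.presheaf.map (homOfLE hVU).op) ≫ U.2.fromSpec) :=
    Category.assoc _ _ _
  have e4 : Spec.map (Y.presheaf.map (homOfLE hVU).op) ≫ U.2.fromSpec = V.2.fromSpec :=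
    IsAffineOpen.map_fromSpec U.2 V.2 _
  have e5 : affineCobordantBlowup.plusπ (R.chartIdeals V) ≫
        (Spec.map (Y.presheaf.map (homOfLE hVU).op) ≫ U.2.fromSpec) = R.cobordantPlusι V :=
    affineCobordantBlowup.plusπ (R.chartIdeals V) ≫= e4
  exact ⟨j, h1, e1.trans (e2.trans (e3.trans e5)), h3, h4, h5⟩

end Assembly


end CobordantPlusBasicOpen

/-! ## The stub -/

/-- **The cobordant blow-up of a basic open is an open piece of the cobordant blow-up** (stub
`stub_cobordantPlus_basicOpen_openImmersion` of line `support-first-weights-second`, registered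
signature; conditional on the ring statement `H` = stub `stub_strictTransform_localization`:
strict transforms and vertices localise). For a Rees algebra `R` on a scheme `Y`, an affine open
`U`, `h ∈ Γ(Y, U)` and an ideal sheaf `X`: `Γ(B(D(h))) = Γ(B(U))[1/h]` along the base change `ψ`
of Laurent polynomials (`stub_extReesAlgebra_localization`), so `Spec ψ : B(D(h)) → B(U)` is an
open immersion onto `D(h)` over `Spec Γ(Y, D(h)) → Spec Γ(Y, U)`; by `H` it pulls the vertex back
to the vertex — hence restricts to an open immersion `j : B₊(D(h)) → B₊(U)` over `Y` whose image is
`B₊(U) ∩ D(h)`, i.e. contains every point of `B₊(U)` over `D(h)` —, the exceptional divisor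
`V(t⁻¹)` to the exceptional divisor, and the strict transform of `X ∩ U` to the strict transform
of `X ∩ D(h)` (Włodarczyk, arXiv:2203.03090, Def. 2.3.5, 3.3.12–3.3.13 and App. Def. 5.1.1: the
cobordant blow-up `B = Spec_Y(𝒪_Y[t⁻¹, Rₙ tⁿ])` is a relative spectrum, computed chartwise).
[cite: Wlodarczyk2022, Def. 2.3.5 and Def. 5.1.1] -/
theorem stub_cobordantPlus_basicOpen_openImmersion :
    (∀ {A A' : Type} [CommRing A] [CommRing A'] [Algebra A A'] (h : A) [IsLocalization.Away h A']
      (I : ℕ → Ideal A) (I' : ℕ → Ideal A'), (∀ n, I' n = (I n).map (algebraMap A A')) →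
      ∀ (ψ : extReesAlgebra I →+* extReesAlgebra I'),
        (∀ x : extReesAlgebra I, ((ψ x : extReesAlgebra I') : A'[T;T⁻¹]) =
            AddMonoidAlgebra.mapRingHom ℤ (algebraMap A A') (x : A[T;T⁻¹])) →
        ψ (extReesAlgebra.tInv I) = extReesAlgebra.tInv I' ∧
        (extReesAlgebra.vertexIdeal I).map ψ = extReesAlgebra.vertexIdeal I' ∧
        ∀ 𝔞 : Ideal A, (extReesAlgebra.strictTransform I 𝔞).map ψ =
          extReesAlgebra.strictTransform I' (𝔞.map (algebraMap A A'))) →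
    ∀ ⦃Y : Scheme.{0}⦄ (R : ReesAlgebraData Y) (U : Y.affineOpens) (h : Γ(Y, U))
      (X : Y.IdealSheafData),
      ∃ j : R.cobordantPlus (Y.affineBasicOpen h) ⟶ R.cobordantPlus U, IsOpenImmersion j ∧
        j ≫ R.cobordantPlusι U = R.cobordantPlusι (Y.affineBasicOpen h) ∧
        (R.cobordantStrictTransform U X).comap j =
          R.cobordantStrictTransform (Y.affineBasicOpen h) X ∧
        (∀ b' : R.cobordantPlus (Y.affineBasicOpen h),
          (affineCobordantBlowup.plusOpens (R.chartIdeals U)).ι (j b') ∈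
              ((affineCobordantBlowup.exceptional (R.chartIdeals U)).support :
                Set (affineCobordantBlowup (R.chartIdeals U))) ↔
            (affineCobordantBlowup.plusOpens (R.chartIdeals (Y.affineBasicOpen h))).ι b' ∈
              ((affineCobordantBlowup.exceptional (R.chartIdeals (Y.affineBasicOpen h))).support :
                Set (affineCobordantBlowup (R.chartIdeals (Y.affineBasicOpen h))))) ∧
        (∀ b : R.cobordantPlus U, R.cobordantPlusι U b ∈ Y.basicOpen h → ∃ b', j b' = b) := by
  intro H Y R U h X
  -- the restriction `Γ(Y, U) → Γ(Y, D(h))` is the localisation away from `h`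
  letI alg : Algebra Γ(Y, U) Γ(Y, (Y.affineBasicOpen h : Y.Opens)) :=
    Scheme.algebra_section_section_basicOpen h
  haveI hlocA : IsLocalization.Away h Γ(Y, (Y.affineBasicOpen h : Y.Opens)) :=
    U.2.isLocalization_basicOpen h
  -- the pieces and `X` over `D(h)` are the extensions of those over `U` (quasi-coherence)
  have hI' : ∀ n, R.chartIdeals (Y.affineBasicOpen h) n =
      (R.chartIdeals U n).map (algebraMap Γ(Y, U) Γ(Y, (Y.affineBasicOpen h : Y.Opens))) :=
    fun n => ((R.piece n).map_ideal_basicOpen U h).symm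
  have hX : X.ideal (Y.affineBasicOpen h) =
      (X.ideal U).map (algebraMap Γ(Y, U) Γ(Y, (Y.affineBasicOpen h : Y.Opens))) :=
    (X.map_ideal_basicOpen U h).symm
  -- `Γ(B(D(h))) = Γ(B(U))[1/h]` along `ψ`, and the consequences of `H`
  obtain ⟨ψ, hψ, hloc⟩ := stub_extReesAlgebra_localization h (R.chartIdeals U)
    (R.chartIdeals (Y.affineBasicOpen h)) hI'
  obtain ⟨hs, hvert, hst⟩ := H h (R.chartIdeals U) (R.chartIdeals (Y.affineBasicOpen h)) hI' ψ hψ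
  -- `ψ` extends the restriction map (it is the base change of Laurent polynomials)
  have hψC : ∀ a : Γ(Y, U),
      ψ (algebraMap Γ(Y, U) (extReesAlgebra (R.chartIdeals U)) a) =
        algebraMap Γ(Y, (Y.affineBasicOpen h : Y.Opens))
          (extReesAlgebra (R.chartIdeals (Y.affineBasicOpen h)))
          ((Y.presheaf.map (homOfLE (Y.basicOpen_le h)).op).hom a) := by
    intro a
    apply Subtype.ext
    rw [hψ, Subalgebra.coe_algebraMap, Subalgebra.coe_algebraMap,
      ← LaurentPolynomial.C_eq_algebraMap, ← LaurentPolynomial.C_eq_algebraMap,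
      extReesLoc_mapRingHom_C]
    rfl
  obtain ⟨j, h1, h2, h3, h4, h5⟩ :=
    CobordantPlusBasicOpen.exists_openImmersion_cobordantPlus R U (Y.affineBasicOpen h)
      (Y.basicOpen_le h) X ψ (algebraMap Γ(Y, U) (extReesAlgebra (R.chartIdeals U)) h) hloc
      hψC hs hvert (by rw [hX]; exact hst (X.ideal U))
  refine ⟨j, h1, h2, h3, h4, fun b hb => h5 b ?_⟩
  -- a point of `B₊(U)` over `D(h)`: `h` is not in the contraction of the prime to `Γ(Y, U)`
  have hq : affineCobordantBlowup.π (R.chartIdeals U)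
      ((affineCobordantBlowup.plusOpens (R.chartIdeals U)).ι b) ∈
        U.2.fromSpec ⁻¹ᵁ Y.basicOpen h := hb
  rw [U.2.fromSpec_preimage_basicOpen] at hq
  exact (PrimeSpectrum.mem_basicOpen _ _).mp hq

end Summit.ResolutionOfSingularities.ResolutionOfSingularities.Theorems
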